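import Mathlib
import Summits.Ventures.HodgeRepro2.Tier7.Line3.InertLevelBase

/-!
# Tier7/Line3/InertLevelIdeal — «`𝔭_{v₁}^n 𝓞_{E,w} = 𝔪_w^n`» as an `Ideal.map` statement in the valuation ring of the completion
(seat t7-L1-p4, gen 6; the one clause left in words by InertLevelBase p714738 — plan-3 STATUS l. 16127 (3), crit-2 l. 16152 (iii))

LINE 3 (t7-plan-3), version (ii). InertLevelBase (t7-x1, p714738) consumes the displayed `e = 1` of the place datum
`(K, E, v, w, [w.asIdeal.LiesOver v.asIdeal])` through the level read in the BASE field (`mem_levelTower_iff_of_integral_base`)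
and, through a base uniformiser, on every `g ∈ GL₂(E_w)` (`mem_levelTower_iff_valued_le_pow_uniformizer`); what it left
in words is the IDEAL IDENTITY «`𝔭_{v₁}^n 𝓞_{E,w} = 𝔪_w^n`» in the valuation ring `𝓞_{E,w} := w.adicCompletionIntegers E`
of Mathlib's completion. This module states it, with `e = 1` displayed and `ϖ ∈ 𝓞 K` a uniformiser of `K` at `v`
(`hϖ : v.intValuation ϖ = exp (−1)`), `ι := 𝓞 K → 𝓞 E → 𝓞_{E,w}` the composite algebra map:

* `mem_span_uniformizer_pow_iff`: `x ∈ Ideal.span {ι ϖ} ^ n ↔ Valued.v (x : E_w) ≤ exp (−n)` for every `x ∈ 𝓞_{E,w}` —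
  the `n`-th power of the maximal ideal, generated by the BASE uniformiser (`e = 1`), is the closed ball of radius
  `exp (−n)` (`Valuation.Integers.le_iff_dvd` for the integers `adicCompletionIntegers.integers`, `Ideal.span_singleton_pow`,
  InertLevelBase's `valued_uniformizer_eq`);
* `map_pow_eq_span_uniformizer_pow`: `Ideal.map ι (v.asIdeal ^ n) = Ideal.span {ι ϖ} ^ n` — THE IDENTITY
  «`𝔭_{v₁}^n 𝓞_{E,w} = 𝔪_w^n`» (`⊆` by the ball description + InertLevelBase's `valued_coe_le_pow_iff_base`; `⊇` since
  `ϖ^n ∈ 𝔭_{v₁}^n`); `mem_map_pow_iff`: `x ∈ Ideal.map ι (v.asIdeal ^ n) ↔ Valued.v (x : E_w) ≤ exp (−n)`;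
* THE CONSUMER `mem_levelTower_iff_sub_one_mem_map`: for EVERY `g ∈ GL₂(E_w)`,
  `g ∈ levelTower normAbv _ (one_lt_q w) N ↔ ∀ i j, ∃ y ∈ Ideal.map ι (v.asIdeal ^ (N+1)), (y : E_w) = (g − 1) i j` —
  «`g ≡ 1 (mod 𝔭_{v₁}^{N+1} 𝓞_{E,w})`» in IDEAL form: every entry of `g − 1` lies in the ideal `𝔭_{v₁}^{N+1} 𝓞_{E,w}` of
  the valuation ring (their integrality is a CONSEQUENCE of membership in the level, not a hypothesis);
* `mem_map_pow_iff'` / `mem_levelTower_iff_sub_one_mem_map'`: the same with the uniformiser supplied by Mathlib's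
  `intValuation_exists_uniformizer`, so that ONLY `e = 1` is displayed (crit-2 STATUS l. 16165 (iv)); the route for (b)
  is the direct one (`valued_coe_le_pow_iff_base` at `n` on every `x ∈ 𝔭_v^n`; crit-2 l. 16165 (ii)).

WHAT THIS CHANGES IN THE [W] COLUMN (ASSEMBLY-p4.md v5 §7 / InertLevelBase's STILL IN WORDS): the `Ideal.map` identity
«`𝔭_{v₁}^n 𝓞_{E,w} = 𝔪_w^n`» is a theorem of the displayed `e = 1` and a base uniformiser, and the real level
`𝔭_{v₁}^{N+1} 𝓞_{E,w}` of the datum's `K_N` is the kernel's `levelTower N` in ideal form for every `g`. STILL IN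
WORDS: that the real `v₁` has `e = 1` and one prime above it (the datum); «`σ` generates `Gal(E_w/K_{v₁})`» (consumed by
no clause); the identification (a′). Nothing here is about (N), (P), the real `X`, or HC_CM; §8(d): NO. Blind lane:
Mathlib + the HodgeRepro2 prefix; no sorry; axioms ⊆ {propext, Classical.choice, Quot.sound}.
-/

namespace Summit.Ventures.HodgeRepro2.Tier7.Line3.InertLevelIdeal

open IsDedekindDomain IsDedekindDomain.HeightOneSpectrum NumberField WithZero
  Summit.Ventures.HodgeRepro2.Tier7.Line3.LevelTowerTopology
  Summit.Ventures.HodgeRepro2.Tier7.Line3.CongruenceSubgroup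
  Summit.Ventures.HodgeRepro2.Tier7.Line3.AdicCompletionLevel
  Summit.Ventures.HodgeRepro2.Tier7.Line3.InertLevelBase
open scoped NumberField WithZero

variable {K E : Type*} [Field K] [NumberField K] [Field E] [NumberField E] [Algebra K E]
  (v : HeightOneSpectrum (𝓞 K)) (w : HeightOneSpectrum (𝓞 E)) [w.asIdeal.LiesOver v.asIdeal]

/-! ## The composite map `𝓞 K → 𝓞 E → 𝓞_{E,w}` -/

/-- the composite ring map `ι : 𝓞 K → 𝓞 E → 𝓞_{E,w}` into the valuation ring `w.adicCompletionIntegers E` of the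
completion of `E` at `w`. -/
noncomputable def ι (w : HeightOneSpectrum (𝓞 E)) : 𝓞 K →+* w.adicCompletionIntegers E :=
  (algebraMap (𝓞 E) (w.adicCompletionIntegers E)).comp (algebraMap (𝓞 K) (𝓞 E))

omit [NumberField K] in
/-- `ι x`, read in the completion, is the image of the base integer `x` along `𝓞 K → 𝓞 E → E → E_w`. -/
theorem coe_ι (x : 𝓞 K) :
    ((ι w x : w.adicCompletionIntegers E) : w.adicCompletion E) =
      ((algebraMap (𝓞 E) E (algebraMap (𝓞 K) (𝓞 E) x) : E) : w.adicCompletion E) := rfl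

/-- a uniformiser of `K` at `v` lies in `𝔭_v`. -/
theorem mem_of_intValuation_eq (ϖ : 𝓞 K) (hϖ : v.intValuation ϖ = exp (-1 : ℤ)) : ϖ ∈ v.asIdeal := by
  rw [← Ideal.span_singleton_le_iff_mem, ← Ideal.dvd_iff_le, ← pow_one v.asIdeal,
    ← intValuation_le_pow_iff_dvd, hϖ]
  simp

/-! ## The `n`-th power of the maximal ideal, generated by the base uniformiser, is the closed ball of radius `exp (−n)` -/

/-- **the ball description of `𝔪_w^n`** (`e = 1`): for `x` in the valuation ring `𝓞_{E,w}`,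
`x ∈ (ι ϖ) ^ n · 𝓞_{E,w} ↔ Valued.v x ≤ exp (−n)`. -/
theorem mem_span_uniformizer_pow_iff (he : v.asIdeal.ramificationIdx' w.asIdeal = 1) (ϖ : 𝓞 K)
    (hϖ : v.intValuation ϖ = exp (-1 : ℤ)) (n : ℕ) (x : w.adicCompletionIntegers E) :
    x ∈ Ideal.span {ι w ϖ} ^ n ↔ Valued.v (x : w.adicCompletion E) ≤ exp (-(n : ℤ)) := by
  rw [Ideal.span_singleton_pow, Ideal.mem_span_singleton,
    ← (adicCompletionIntegers.integers E w).le_iff_dvd]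
  have hϖw : Valued.v ((ι w ϖ : w.adicCompletionIntegers E) : w.adicCompletion E) = exp (-1 : ℤ) := by
    rw [coe_ι]
    exact valued_uniformizer_eq v w he ϖ hϖ
  have hpow : Valued.v (((ι w ϖ ^ n : w.adicCompletionIntegers E) : w.adicCompletion E)) = exp (-(n : ℤ)) := by
    rw [SubmonoidClass.coe_pow, Valuation.map_pow, hϖw, ← exp_nsmul]
    simp only [nsmul_eq_mul, mul_neg, mul_one]
  change Valued.v (x : w.adicCompletion E) ≤ Valued.v ((ι w ϖ ^ n : w.adicCompletionIntegers E) : w.adicCompletion E) ↔ _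
  rw [hpow]

/-! ## «`𝔭_{v₁}^n 𝓞_{E,w} = 𝔪_w^n`» -/

/-- **the ideal identity `𝔭_{v₁}^n 𝓞_{E,w} = 𝔪_w^n`** in the valuation ring of the completion (`e = 1` DISPLAYED, `ϖ` a
base uniformiser): `Ideal.map ι (𝔭_v ^ n) = (ι ϖ · 𝓞_{E,w}) ^ n`. -/
theorem map_pow_eq_span_uniformizer_pow (he : v.asIdeal.ramificationIdx' w.asIdeal = 1) (ϖ : 𝓞 K)
    (hϖ : v.intValuation ϖ = exp (-1 : ℤ)) (n : ℕ) :
    Ideal.map (ι w) (v.asIdeal ^ n) = Ideal.span {ι w ϖ} ^ n := by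
  apply le_antisymm
  · rw [Ideal.map_le_iff_le_comap]
    intro x hx
    rw [Ideal.mem_comap, mem_span_uniformizer_pow_iff v w he ϖ hϖ, coe_ι]
    exact (valued_coe_le_pow_iff_base v w he x n).mpr hx
  · rw [Ideal.span_singleton_pow, Ideal.span_singleton_le_iff_mem, ← map_pow]
    exact Ideal.mem_map_of_mem _ (Ideal.pow_mem_pow (mem_of_intValuation_eq v ϖ hϖ) n)

/-- **membership in `𝔭_{v₁}^n 𝓞_{E,w}` is the ball of radius `exp (−n)`** (`e = 1`). -/
theorem mem_map_pow_iff (he : v.asIdeal.ramificationIdx' w.asIdeal = 1) (ϖ : 𝓞 K)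
    (hϖ : v.intValuation ϖ = exp (-1 : ℤ)) (n : ℕ) (x : w.adicCompletionIntegers E) :
    x ∈ Ideal.map (ι w) (v.asIdeal ^ n) ↔ Valued.v (x : w.adicCompletion E) ≤ exp (-(n : ℤ)) := by
  rw [map_pow_eq_span_uniformizer_pow v w he ϖ hϖ, mem_span_uniformizer_pow_iff v w he ϖ hϖ]

/-! ## The consumer: the level tower in ideal form, for every `g ∈ GL₂(E_w)` -/

/-- **the level tower at `q := q w` in IDEAL form, for EVERY `g ∈ GL₂(E_w)`**: `g ∈ K_N ↔` every entry of `g − 1`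
is (the image in `E_w` of) an element of the ideal `𝔭_{v₁}^{N+1} 𝓞_{E,w}` of the valuation ring — «`g ≡ 1 (mod
𝔭_{v₁}^{N+1} 𝓞_{E,w})`» (`e = 1` DISPLAYED; the integrality of the entries of `g − 1` is a consequence, not a hypothesis).
Composed from `AdicCompletionLevel.mem_levelTower_iff` (p705534) and `mem_map_pow_iff`. -/
theorem mem_levelTower_iff_sub_one_mem_map (he : v.asIdeal.ramificationIdx' w.asIdeal = 1) (ϖ : 𝓞 K)
    (hϖ : v.intValuation ϖ = exp (-1 : ℤ)) (N : ℕ) (g : GL (Fin 2) (w.adicCompletion E)) :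
    g ∈ levelTower normAbv isNonarchimedean_normAbv (one_lt_q w) N ↔
      ∀ i j, ∃ y ∈ Ideal.map (ι w) (v.asIdeal ^ (N + 1)),
        (y : w.adicCompletion E) = ((g : Matrix (Fin 2) (Fin 2) (w.adicCompletion E)) - 1) i j := by
  rw [mem_levelTower_iff]
  refine forall₂_congr fun i j => ⟨fun h => ?_, ?_⟩
  · have hmem : ((g : Matrix (Fin 2) (Fin 2) (w.adicCompletion E)) - 1) i j ∈ w.adicCompletionIntegers E := by
      rw [mem_adicCompletionIntegers]
      refine h.trans ?_
      rw [← exp_zero]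
      exact exp_le_exp.mpr (by omega)
    exact ⟨⟨_, hmem⟩, (mem_map_pow_iff v w he ϖ hϖ _ _).mpr h, rfl⟩
  · rintro ⟨y, hy, hyx⟩
    rw [← hyx]
    exact (mem_map_pow_iff v w he ϖ hϖ _ _).mp hy

/-! ## The same with the uniformiser discharged (only `e = 1` displayed; crit-2 STATUS l. 16165 (iv)) -/

/-- **membership in `𝔭_{v₁}^n 𝓞_{E,w}` is the ball of radius `exp (−n)`**, with the base uniformiser supplied by Mathlib's
`intValuation_exists_uniformizer` — only `e = 1` is displayed. -/
theorem mem_map_pow_iff' (he : v.asIdeal.ramificationIdx' w.asIdeal = 1) (n : ℕ)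
    (x : w.adicCompletionIntegers E) :
    x ∈ Ideal.map (ι w) (v.asIdeal ^ n) ↔ Valued.v (x : w.adicCompletion E) ≤ exp (-(n : ℤ)) := by
  obtain ⟨ϖ, hϖ⟩ := v.intValuation_exists_uniformizer
  exact mem_map_pow_iff v w he ϖ hϖ n x

/-- **the level tower in ideal form, for every `g ∈ GL₂(E_w)`, with only `e = 1` displayed** (the uniformiser of
`mem_levelTower_iff_sub_one_mem_map` supplied by `intValuation_exists_uniformizer`). -/
theorem mem_levelTower_iff_sub_one_mem_map' (he : v.asIdeal.ramificationIdx' w.asIdeal = 1) (N : ℕ)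
    (g : GL (Fin 2) (w.adicCompletion E)) :
    g ∈ levelTower normAbv isNonarchimedean_normAbv (one_lt_q w) N ↔
      ∀ i j, ∃ y ∈ Ideal.map (ι w) (v.asIdeal ^ (N + 1)),
        (y : w.adicCompletion E) = ((g : Matrix (Fin 2) (Fin 2) (w.adicCompletion E)) - 1) i j := by
  obtain ⟨ϖ, hϖ⟩ := v.intValuation_exists_uniformizer
  exact mem_levelTower_iff_sub_one_mem_map v w he ϖ hϖ N g

end Summit.Ventures.HodgeRepro2.Tier7.Line3.InertLevelIdeal
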